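import Literature.NumberTheory.EllipticCurves.FormalGroupXDerivativeReadProofs
import Literature.NumberTheory.EllipticCurves.SigmaODELogDerivProofs
import Literature.NumberTheory.EllipticCurves.FormalGroupLawAddXProofs
import Literature.NumberTheory.EllipticCurves.SigmaThetaLeadingCoeffProofs
import HarnessLib

/-!
# The theta relation, Step A: both sides have the same second logarithmic `u`-derivative
# (Blakestad–Grant 2023, Prop. 14: "the second logarithmic derivations in `t₁` of both sides agree")

Trunk T-NT-EC (Literature/NumberTheory/EllipticCurves). Pure proof file on the way to the formal
Mazur–Tate theta relation (named fact `WeierstrassCurve.padicSigma_theta_formal`,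
`CanonicalPAdicHeightThetaProofs.lean`). For a normalised solution `σ` of the sigma equation of
`V/ℚ_p` (elliptic, `p`-integral equation) and the two pole-cleared sides
`L = σ(F)σ(Fm)u²v²` (`thetaLHS`), `R = (u²X(v) - v²X(u))σ(u)²σ(v)²` (`thetaRHS`) of the theta
relation (`F = u +_F v`, `Fm = u -_F v`, `X = z²x`), with `D₁ = η(u)∂/∂u` and
`N(f) = f·D₁²f - (D₁f)²` (`logDeriv₂Num`):

* `logDeriv₂Num_thetaLHS_ratio` — `N(L)·(F²Fm²u²) = n_L·L²` with
  `n_L = -(X(F) + cF²)Fm²u² - (X(Fm) + cFm²)F²u² + 2κF²Fm²`, `κ = u·(Dη)(u) - η(u)²`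
  (ratio data of `σ(F)`, `σ(Fm)` from the sigma equation through the invariant derivation,
  `SigmaODELogDerivProofs.lean`; of `u²`, `v²` directly): `(log L)'' = -x(F) - x(Fm) - 2c + (log u²)''`;
* `logDeriv₂Num_thetaRHS_ratio` — `N(R)·(ε²X(u)²u²) = n_R·R²` for the factorisation
  `R = ε·X(u)·X(v)·σ(u)²·σ(v)²`, `ε = ξ(u) - ξ(v)`, `ξ = z²B = 1/x`
  (`(log R)'' = (log(1/x(u) - 1/x(v)))'' + (log X(u))'' - 2(x(u) + c)`);
* `thetaLHS_ratio_mul_eq` — **`n_L·(ε²X(u)²u²) = n_R·(F²Fm²u²)`**: the two second logarithmic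
  derivatives AGREE. This is Blakestad–Grant's Lemma 10 in the formal group: after the
  `x`-calculus of `FormalGroupXDerivativeProofs.lean` (`Dx = 2y + a₁x + a₃`, `DY = 6x² + b₂x + b₄`,
  `D(1/x)`, `D²(1/x)`, the Weierstrass equation) it is exactly the addition formula
  `formalGroupLaw_addX_identity` (`FormalGroupLawAddXProofs.lean`); closed by
  `linear_combination` with machine-found cofactors;
(hence `N(L)·R² = N(R)·L²`, `logDeriv₂Num_thetaLHS_mul_sq_eq` in
`CanonicalPAdicHeightThetaFormalProofs.lean`).

## Sources

* C. Blakestad, D. Grant, J. Number Theory 249 (2023) (arXiv:1903.02480), §3: Lemma 10, Prop. 14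
  and its proof (first two displays).
* B. Mazur, J. Tate, Duke Math. J. 62 (1991), Thm. 3.1; B. Mazur, W. Stein, J. Tate (2006), Thm. 1.3.

## Design notes

No definitions, no named facts. The `σ`-hypotheses are `σ(0) = 0`, `σ'(0) = 1` and
`SatisfiesSigmaODE V σ c`. One-variable identities are read in the variable `u` through the
substitution homomorphism `PowerSeries.subst (X 0)`.
-/

noncomputable section

open scoped Classical
open PowerSeries Literature.NumberTheory.EllipticCurves
open Literature.AlgebraicGeometry.Resolution (MvPowerSeries.pderiv MvPowerSeries.pderiv_X
  MvPowerSeries.pderiv_powerSeries_subst_X)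

namespace WeierstrassCurve



/-! ### Step A: ratio data of the two sides -/

section StepA

variable {p : ℕ} [Fact p.Prime] (V : WeierstrassCurve ℚ_[p]) {σ : ℚ_[p]⟦X⟧} {c : ℚ_[p]}

/-- **Ratio data of the left side**: `N(L)·(F²Fm²u²) = n_L·L²`,
`n_L = (-(X(F) + cF²)Fm² - (X(Fm) + cFm²)F²)u² + 2κF²Fm²`, `κ = u(Dη)(u) - η(u)²`
(`(log L)'' = -(x(F)+c) - (x(Fm)+c) + (log u²)''`). [Blakestad–Grant 2023, proof of Prop. 14]
[folklore] -/
theorem logDeriv₂Num_thetaLHS_ratio (hσ0 : constantCoeff σ = 0) (hσ1 : coeff 1 σ = 1)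
    (hODE : V.SatisfiesSigmaODE σ c) :
    logDeriv₂Num (V.formalInvariantDerivationMv 0) (V.thetaLHS σ) *
        (V.formalGroupLaw ^ 2 * V.formalGroupLawSub ^ 2 *
          (MvPowerSeries.X 0 : MvPowerSeries (Fin 2) ℚ_[p]) ^ 2) =
      ((-(V.formalXMulSq.subst V.formalGroupLaw + MvPowerSeries.C c * V.formalGroupLaw ^ 2) *
              V.formalGroupLawSub ^ 2 -
            (V.formalXMulSq.subst V.formalGroupLawSub + MvPowerSeries.C c * V.formalGroupLawSub ^ 2) *
              V.formalGroupLaw ^ 2) * (MvPowerSeries.X 0 : MvPowerSeries (Fin 2) ℚ_[p]) ^ 2 +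
          2 * ((MvPowerSeries.X 0 : MvPowerSeries (Fin 2) ℚ_[p]) *
              (V.formalInvariantDerivation V.formalEta).subst (MvPowerSeries.X 0 : MvPowerSeries (Fin 2) ℚ_[p]) -
            V.formalEta.subst (MvPowerSeries.X 0 : MvPowerSeries (Fin 2) ℚ_[p]) ^ 2) *
            V.formalGroupLaw ^ 2 * V.formalGroupLawSub ^ 2) *
        V.thetaLHS σ ^ 2 := by
  set D₁ := V.formalInvariantDerivationMv (0 : Fin 2) with hD₁
  set u := (MvPowerSeries.X 0 : MvPowerSeries (Fin 2) ℚ_[p]) with hu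
  set v := (MvPowerSeries.X 1 : MvPowerSeries (Fin 2) ℚ_[p]) with hv
  have hDu : D₁ u = V.formalEta.subst u := by
    rw [hD₁, hu]; exact V.formalInvariantDerivationMv_X_self 0
  have hDη : D₁ (V.formalEta.subst u) = (V.formalInvariantDerivation V.formalEta).subst u := by
    rw [hD₁, hu]; exact V.formalInvariantDerivationMv_subst_X_zero V.formalEta
  have hDv : D₁ v = 0 := by
    rw [hD₁, hv]; exact V.formalInvariantDerivationMv_X_of_ne (by decide)
  have h1 : logDeriv₂Num D₁ (σ.subst V.formalGroupLaw) * V.formalGroupLaw ^ 2 =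
      (-(V.formalXMulSq.subst V.formalGroupLaw + MvPowerSeries.C c * V.formalGroupLaw ^ 2)) *
        σ.subst V.formalGroupLaw ^ 2 := by
    linear_combination sq_mul_logDeriv₂Num_sigma_subst_formalGroupLaw hσ0 hσ1 hODE
  have h2 : logDeriv₂Num D₁ (σ.subst V.formalGroupLawSub) * V.formalGroupLawSub ^ 2 =
      (-(V.formalXMulSq.subst V.formalGroupLawSub + MvPowerSeries.C c * V.formalGroupLawSub ^ 2)) *
        σ.subst V.formalGroupLawSub ^ 2 := by
    linear_combination sq_mul_logDeriv₂Num_sigma_subst_formalGroupLawSub hσ0 hσ1 hODE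
  have h3 : logDeriv₂Num D₁ (u ^ 2) * u ^ 2 =
      (2 * (u * (V.formalInvariantDerivation V.formalEta).subst u - V.formalEta.subst u ^ 2)) *
        (u ^ 2) ^ 2 := by
    rw [logDeriv₂Num_sq, logDeriv₂Num, hDu, hDη]; ring
  have h4 : logDeriv₂Num D₁ (v ^ 2) * 1 = 0 * (v ^ 2) ^ 2 := by
    rw [logDeriv₂Num_of_apply_eq_zero D₁ (by rw [Derivation.leibniz_pow, hDv, smul_zero, smul_zero])]; ring
  have h := logDeriv₂Num_mul_ratio D₁ (logDeriv₂Num_mul_ratio D₁ (logDeriv₂Num_mul_ratio D₁ h1 h2) h3) h4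
  unfold thetaLHS
  rw [← hu, ← hv]
  linear_combination h

/-- `ε·X(u)·X(v) = u²X(v) - v²X(u)` for `ε = ξ(u) - ξ(v)`, `ξ = z²B = 1/x`. [folklore] -/
theorem eps_mul_formalXMulSq_mul :
    ((X ^ 2 * V.formalWDivCube).subst (MvPowerSeries.X 0 : MvPowerSeries (Fin 2) ℚ_[p]) -
        (X ^ 2 * V.formalWDivCube).subst (MvPowerSeries.X 1 : MvPowerSeries (Fin 2) ℚ_[p])) *
        V.formalXMulSq.subst (MvPowerSeries.X 0 : MvPowerSeries (Fin 2) ℚ_[p]) *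
        V.formalXMulSq.subst (MvPowerSeries.X 1 : MvPowerSeries (Fin 2) ℚ_[p]) =
      (MvPowerSeries.X 0 : MvPowerSeries (Fin 2) ℚ_[p]) ^ 2 *
          V.formalXMulSq.subst (MvPowerSeries.X 1 : MvPowerSeries (Fin 2) ℚ_[p]) -
        (MvPowerSeries.X 1 : MvPowerSeries (Fin 2) ℚ_[p]) ^ 2 *
          V.formalXMulSq.subst (MvPowerSeries.X 0 : MvPowerSeries (Fin 2) ℚ_[p]) := by
  linear_combination V.formalXMulSq.subst (MvPowerSeries.X 1 : MvPowerSeries (Fin 2) ℚ_[p]) *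
      V.read_xInv_mul_formalXMulSq 0 -
    V.formalXMulSq.subst (MvPowerSeries.X 0 : MvPowerSeries (Fin 2) ℚ_[p]) * V.read_xInv_mul_formalXMulSq 1

/-- The right side factored: `R = ε·X(u)·X(v)·σ(u)²·σ(v)²`. [folklore] -/
theorem thetaRHS_eq_eps_mul (σ : ℚ_[p]⟦X⟧) :
    V.thetaRHS σ =
      ((X ^ 2 * V.formalWDivCube).subst (MvPowerSeries.X 0 : MvPowerSeries (Fin 2) ℚ_[p]) -
          (X ^ 2 * V.formalWDivCube).subst (MvPowerSeries.X 1 : MvPowerSeries (Fin 2) ℚ_[p])) *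
        V.formalXMulSq.subst (MvPowerSeries.X 0 : MvPowerSeries (Fin 2) ℚ_[p]) *
        V.formalXMulSq.subst (MvPowerSeries.X 1 : MvPowerSeries (Fin 2) ℚ_[p]) *
        σ.subst (MvPowerSeries.X 0 : MvPowerSeries (Fin 2) ℚ_[p]) ^ 2 *
        σ.subst (MvPowerSeries.X 1 : MvPowerSeries (Fin 2) ℚ_[p]) ^ 2 := by
  unfold thetaRHS
  rw [V.eps_mul_formalXMulSq_mul]

/-- **Ratio data of the right side**: `N(R)·(ε²X(u)²u²) = n_R·R²` with
`n_R = (N(ε)X(u)² + N(X(u))ε²)u² - 2(X(u) + cu²)ε²X(u)²`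
(`(log R)'' = (log ε)'' + (log X(u))'' - 2(x(u) + c)`). [Blakestad–Grant 2023, proof of Prop. 14]
[folklore] -/
theorem logDeriv₂Num_thetaRHS_ratio (hσ0 : constantCoeff σ = 0) (hσ1 : coeff 1 σ = 1)
    (hODE : V.SatisfiesSigmaODE σ c) :
    logDeriv₂Num (V.formalInvariantDerivationMv 0) (V.thetaRHS σ) *
        (((X ^ 2 * V.formalWDivCube).subst (MvPowerSeries.X 0 : MvPowerSeries (Fin 2) ℚ_[p]) -
            (X ^ 2 * V.formalWDivCube).subst (MvPowerSeries.X 1 : MvPowerSeries (Fin 2) ℚ_[p])) ^ 2 *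
          V.formalXMulSq.subst (MvPowerSeries.X 0 : MvPowerSeries (Fin 2) ℚ_[p]) ^ 2 *
          (MvPowerSeries.X 0 : MvPowerSeries (Fin 2) ℚ_[p]) ^ 2) =
      ((logDeriv₂Num (V.formalInvariantDerivationMv 0)
              ((X ^ 2 * V.formalWDivCube).subst (MvPowerSeries.X 0 : MvPowerSeries (Fin 2) ℚ_[p]) -
                (X ^ 2 * V.formalWDivCube).subst (MvPowerSeries.X 1 : MvPowerSeries (Fin 2) ℚ_[p])) *
              V.formalXMulSq.subst (MvPowerSeries.X 0 : MvPowerSeries (Fin 2) ℚ_[p]) ^ 2 +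
            logDeriv₂Num (V.formalInvariantDerivationMv 0)
                (V.formalXMulSq.subst (MvPowerSeries.X 0 : MvPowerSeries (Fin 2) ℚ_[p])) *
              ((X ^ 2 * V.formalWDivCube).subst (MvPowerSeries.X 0 : MvPowerSeries (Fin 2) ℚ_[p]) -
                (X ^ 2 * V.formalWDivCube).subst (MvPowerSeries.X 1 : MvPowerSeries (Fin 2) ℚ_[p])) ^ 2) *
            (MvPowerSeries.X 0 : MvPowerSeries (Fin 2) ℚ_[p]) ^ 2 -
          2 * (V.formalXMulSq.subst (MvPowerSeries.X 0 : MvPowerSeries (Fin 2) ℚ_[p]) +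
              MvPowerSeries.C c * (MvPowerSeries.X 0 : MvPowerSeries (Fin 2) ℚ_[p]) ^ 2) *
            ((X ^ 2 * V.formalWDivCube).subst (MvPowerSeries.X 0 : MvPowerSeries (Fin 2) ℚ_[p]) -
              (X ^ 2 * V.formalWDivCube).subst (MvPowerSeries.X 1 : MvPowerSeries (Fin 2) ℚ_[p])) ^ 2 *
            V.formalXMulSq.subst (MvPowerSeries.X 0 : MvPowerSeries (Fin 2) ℚ_[p]) ^ 2) *
        V.thetaRHS σ ^ 2 := by
  -- the sigma equation read in `u` (before abbreviating)
  have h4 : logDeriv₂Num (V.formalInvariantDerivationMv 0)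
        (σ.subst (MvPowerSeries.X 0 : MvPowerSeries (Fin 2) ℚ_[p]) ^ 2) *
        (MvPowerSeries.X 0 : MvPowerSeries (Fin 2) ℚ_[p]) ^ 2 =
      (-2 * (V.formalXMulSq.subst (MvPowerSeries.X 0 : MvPowerSeries (Fin 2) ℚ_[p]) +
          MvPowerSeries.C c * (MvPowerSeries.X 0 : MvPowerSeries (Fin 2) ℚ_[p]) ^ 2)) *
        (σ.subst (MvPowerSeries.X 0 : MvPowerSeries (Fin 2) ℚ_[p]) ^ 2) ^ 2 := by
    rw [logDeriv₂Num_sq]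
    linear_combination 2 * σ.subst (MvPowerSeries.X 0 : MvPowerSeries (Fin 2) ℚ_[p]) ^ 2 *
      sq_mul_logDeriv₂Num_sigma_subst_X_zero hσ0 hσ1 hODE
  set D₁ := V.formalInvariantDerivationMv (0 : Fin 2) with hD₁
  set u := (MvPowerSeries.X 0 : MvPowerSeries (Fin 2) ℚ_[p]) with hu
  set v := (MvPowerSeries.X 1 : MvPowerSeries (Fin 2) ℚ_[p]) with hv
  set ε := (X ^ 2 * V.formalWDivCube).subst u - (X ^ 2 * V.formalWDivCube).subst v with hε
  set Xu := V.formalXMulSq.subst u with hXu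
  set Xv := V.formalXMulSq.subst v with hXv
  have hDXv : D₁ Xv = 0 := by rw [hD₁, hXv, hv]; exact V.formalInvariantDerivationMv_subst_X_one _
  have hDσv : D₁ (σ.subst v) = 0 := by rw [hD₁, hv]; exact V.formalInvariantDerivationMv_subst_X_one _
  have h1 : logDeriv₂Num D₁ ε * ε ^ 2 = logDeriv₂Num D₁ ε * ε ^ 2 := rfl
  have h2 : logDeriv₂Num D₁ Xu * Xu ^ 2 = logDeriv₂Num D₁ Xu * Xu ^ 2 := rfl
  have h3 : logDeriv₂Num D₁ Xv * 1 = 0 * Xv ^ 2 := by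
    rw [logDeriv₂Num_of_apply_eq_zero D₁ hDXv]; ring
  have h5 : logDeriv₂Num D₁ (σ.subst v ^ 2) * 1 = 0 * (σ.subst v ^ 2) ^ 2 := by
    rw [logDeriv₂Num_of_apply_eq_zero D₁ (by rw [Derivation.leibniz_pow, hDσv, smul_zero, smul_zero])]
    ring
  have h := logDeriv₂Num_mul_ratio D₁
    (logDeriv₂Num_mul_ratio D₁ (logDeriv₂Num_mul_ratio D₁ (logDeriv₂Num_mul_ratio D₁ h1 h2) h3) h4) h5
  rw [V.thetaRHS_eq_eps_mul σ, ← hu, ← hv, ← hε, ← hXu, ← hXv]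
  linear_combination h

/-! ### Step A: the two second logarithmic derivatives agree (Lemma 10 + the `x`-calculus) -/

/-- `u²·N(X(u)) = 2κX(u)² + 2X(u)³ - b₄u⁴X(u) - b₆u⁶` (`(log X)'' = 2(log z)'' + (log x)''`,
`(log x)'' = (2x³ - b₄x - b₆)/x²`). [Blakestad–Grant 2023, Lemma 10] [folklore] -/
theorem X_sq_mul_logDeriv₂Num_formalXMulSq_subst :
    (MvPowerSeries.X 0 : MvPowerSeries (Fin 2) ℚ_[p]) ^ 2 *
        logDeriv₂Num (V.formalInvariantDerivationMv 0)
          (V.formalXMulSq.subst (MvPowerSeries.X 0 : MvPowerSeries (Fin 2) ℚ_[p])) =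
      2 * ((MvPowerSeries.X 0 : MvPowerSeries (Fin 2) ℚ_[p]) *
            (V.formalInvariantDerivation V.formalEta).subst (MvPowerSeries.X 0 : MvPowerSeries (Fin 2) ℚ_[p]) -
          V.formalEta.subst (MvPowerSeries.X 0 : MvPowerSeries (Fin 2) ℚ_[p]) ^ 2) *
          V.formalXMulSq.subst (MvPowerSeries.X 0 : MvPowerSeries (Fin 2) ℚ_[p]) ^ 2 +
        2 * V.formalXMulSq.subst (MvPowerSeries.X 0 : MvPowerSeries (Fin 2) ℚ_[p]) ^ 3 -
        MvPowerSeries.C V.b₄ * (MvPowerSeries.X 0 : MvPowerSeries (Fin 2) ℚ_[p]) ^ 4 *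
          V.formalXMulSq.subst (MvPowerSeries.X 0 : MvPowerSeries (Fin 2) ℚ_[p]) -
        MvPowerSeries.C V.b₆ * (MvPowerSeries.X 0 : MvPowerSeries (Fin 2) ℚ_[p]) ^ 6 := by
  have hF1 := V.read_X_mul_D_formalXMulSq 0
  have hF1p := V.read_X_mul_D_D_formalXMulSq 0
  have hF2 := V.read_X_mul_D_formalYTilde 0
  have hF0 := V.read_formalYTilde_sq 0
  have hD1 : V.formalInvariantDerivationMv 0
      (V.formalXMulSq.subst (MvPowerSeries.X 0 : MvPowerSeries (Fin 2) ℚ_[p])) =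
      (V.formalInvariantDerivation V.formalXMulSq).subst (MvPowerSeries.X 0 : MvPowerSeries (Fin 2) ℚ_[p]) :=
    V.formalInvariantDerivationMv_subst_X_zero _
  have hD2 : V.formalInvariantDerivationMv 0 ((V.formalInvariantDerivation V.formalXMulSq).subst
      (MvPowerSeries.X 0 : MvPowerSeries (Fin 2) ℚ_[p])) =
      (V.formalInvariantDerivation (V.formalInvariantDerivation V.formalXMulSq)).subst
        (MvPowerSeries.X 0 : MvPowerSeries (Fin 2) ℚ_[p]) :=
    V.formalInvariantDerivationMv_subst_X_zero _
  rw [logDeriv₂Num, hD1, hD2]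
  set u := (MvPowerSeries.X 0 : MvPowerSeries (Fin 2) ℚ_[p])
  set Xu := V.formalXMulSq.subst u
  set DXu := (V.formalInvariantDerivation V.formalXMulSq).subst u
  set ηu := V.formalEta.subst u
  set Ytu := (MvPowerSeries.C V.a₁ * u - 2) * Xu + MvPowerSeries.C V.a₃ * u ^ 3
  linear_combination (u * Xu) * hF1p + (-Ytu - Xu * ηu - u * DXu) * hF1 + Xu * hF2 - hF0

/-- `X(u)⁴·N(ε) = εX(u)(2Ỹ(u)² - X(u)(6X(u)² + b₂u²X(u) + b₄u⁴)) - u²Ỹ(u)²` for `ε = ξ(u) - ξ(v)`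
(`(log(1/x(u) - 1/x(v)))''` from `D(1/x)`, `D²(1/x)`). [Blakestad–Grant 2023, Lemma 10] [folklore] -/
theorem formalXMulSq_pow_four_mul_logDeriv₂Num_eps :
    V.formalXMulSq.subst (MvPowerSeries.X 0 : MvPowerSeries (Fin 2) ℚ_[p]) ^ 4 *
        logDeriv₂Num (V.formalInvariantDerivationMv 0)
          ((X ^ 2 * V.formalWDivCube).subst (MvPowerSeries.X 0 : MvPowerSeries (Fin 2) ℚ_[p]) -
            (X ^ 2 * V.formalWDivCube).subst (MvPowerSeries.X 1 : MvPowerSeries (Fin 2) ℚ_[p])) =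
      ((X ^ 2 * V.formalWDivCube).subst (MvPowerSeries.X 0 : MvPowerSeries (Fin 2) ℚ_[p]) -
            (X ^ 2 * V.formalWDivCube).subst (MvPowerSeries.X 1 : MvPowerSeries (Fin 2) ℚ_[p])) *
          V.formalXMulSq.subst (MvPowerSeries.X 0 : MvPowerSeries (Fin 2) ℚ_[p]) *
          (2 * ((MvPowerSeries.C V.a₁ * MvPowerSeries.X 0 - 2) *
                  V.formalXMulSq.subst (MvPowerSeries.X 0 : MvPowerSeries (Fin 2) ℚ_[p]) +
                MvPowerSeries.C V.a₃ * (MvPowerSeries.X 0) ^ 3) ^ 2 -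
            V.formalXMulSq.subst (MvPowerSeries.X 0 : MvPowerSeries (Fin 2) ℚ_[p]) *
              (6 * V.formalXMulSq.subst (MvPowerSeries.X 0 : MvPowerSeries (Fin 2) ℚ_[p]) ^ 2 +
                MvPowerSeries.C V.b₂ * (MvPowerSeries.X 0 : MvPowerSeries (Fin 2) ℚ_[p]) ^ 2 *
                  V.formalXMulSq.subst (MvPowerSeries.X 0 : MvPowerSeries (Fin 2) ℚ_[p]) +
                MvPowerSeries.C V.b₄ * (MvPowerSeries.X 0 : MvPowerSeries (Fin 2) ℚ_[p]) ^ 4)) -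
        (MvPowerSeries.X 0 : MvPowerSeries (Fin 2) ℚ_[p]) ^ 2 *
          ((MvPowerSeries.C V.a₁ * MvPowerSeries.X 0 - 2) *
              V.formalXMulSq.subst (MvPowerSeries.X 0 : MvPowerSeries (Fin 2) ℚ_[p]) +
            MvPowerSeries.C V.a₃ * (MvPowerSeries.X 0) ^ 3) ^ 2 := by
  have hξ1 := V.read_formalXMulSq_sq_mul_D_xInv 0
  have hξ2 := V.read_formalXMulSq_cube_mul_D_D_xInv 0
  have hD1 : V.formalInvariantDerivationMv 0
      ((X ^ 2 * V.formalWDivCube).subst (MvPowerSeries.X 0 : MvPowerSeries (Fin 2) ℚ_[p]) -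
        (X ^ 2 * V.formalWDivCube).subst (MvPowerSeries.X 1 : MvPowerSeries (Fin 2) ℚ_[p])) =
      (V.formalInvariantDerivation (X ^ 2 * V.formalWDivCube)).subst
        (MvPowerSeries.X 0 : MvPowerSeries (Fin 2) ℚ_[p]) := by
    rw [map_sub, V.formalInvariantDerivationMv_subst_X_zero, V.formalInvariantDerivationMv_subst_X_one,
      sub_zero]
  have hD2 : V.formalInvariantDerivationMv 0 ((V.formalInvariantDerivation (X ^ 2 * V.formalWDivCube)).subst
      (MvPowerSeries.X 0 : MvPowerSeries (Fin 2) ℚ_[p])) =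
      (V.formalInvariantDerivation (V.formalInvariantDerivation (X ^ 2 * V.formalWDivCube))).subst
        (MvPowerSeries.X 0 : MvPowerSeries (Fin 2) ℚ_[p]) :=
    V.formalInvariantDerivationMv_subst_X_zero _
  rw [logDeriv₂Num, hD1, hD2]
  set u := (MvPowerSeries.X 0 : MvPowerSeries (Fin 2) ℚ_[p])
  set Xu := V.formalXMulSq.subst u
  set ε := (X ^ 2 * V.formalWDivCube).subst u -
    (X ^ 2 * V.formalWDivCube).subst (MvPowerSeries.X 1 : MvPowerSeries (Fin 2) ℚ_[p])
  set Dξu := (V.formalInvariantDerivation (X ^ 2 * V.formalWDivCube)).subst u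
  set Ytu := (MvPowerSeries.C V.a₁ * u - 2) * Xu + MvPowerSeries.C V.a₃ * u ^ 3
  linear_combination (Xu * ε) * hξ2 + (-(Xu ^ 2 * Dξu) + u * Ytu) * hξ1

/-- `f ≠ 0` as soon as `f(0, v) ≠ 0`. [folklore] -/
theorem ne_zero_of_subst_zero_X_ne_zero {f : MvPowerSeries (Fin 2) ℚ_[p]}
    (h : MvPowerSeries.subst ![(0 : ℚ_[p]⟦X⟧), PowerSeries.X] f ≠ 0) : f ≠ 0 := by
  rintro rfl
  exact h (by rw [← MvPowerSeries.coe_substAlgHom hasSubst_zero_X, map_zero])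

/-- `X(u) ≠ 0`, `X(v) ≠ 0`, `ε ≠ 0`, `F ≠ 0`, `Fm ≠ 0`, `2 ≠ 0` in `ℚ_p⟦u, v⟧`. [folklore] -/
theorem stepA_factors_ne_zero :
    V.formalXMulSq.subst (MvPowerSeries.X 0 : MvPowerSeries (Fin 2) ℚ_[p]) ≠ 0 ∧
    V.formalXMulSq.subst (MvPowerSeries.X 1 : MvPowerSeries (Fin 2) ℚ_[p]) ≠ 0 ∧
    (X ^ 2 * V.formalWDivCube).subst (MvPowerSeries.X 0 : MvPowerSeries (Fin 2) ℚ_[p]) -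
        (X ^ 2 * V.formalWDivCube).subst (MvPowerSeries.X 1 : MvPowerSeries (Fin 2) ℚ_[p]) ≠ 0 ∧
    V.formalGroupLaw ≠ 0 ∧ V.formalGroupLawSub ≠ 0 ∧ (2 : MvPowerSeries (Fin 2) ℚ_[p]) ≠ 0 := by
  have hX0 : V.formalXMulSq ≠ 0 := fun h => by
    have := congrArg constantCoeff h; rw [V.constantCoeff_formalXMulSq, map_zero] at this
    exact one_ne_zero this
  refine ⟨?_, ?_, ?_, ?_, ?_, ?_⟩
  · refine ne_zero_of_subst_zero_X_ne_zero ?_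
    rw [subst_zero_X_powerSeries_subst_X_zero, V.constantCoeff_formalXMulSq, map_one]; exact one_ne_zero
  · refine ne_zero_of_subst_zero_X_ne_zero ?_
    rw [subst_zero_X_powerSeries_subst_X_one]; exact hX0
  · refine ne_zero_of_subst_zero_X_ne_zero ?_
    rw [MvPowerSeries.subst_sub hasSubst_zero_X, subst_zero_X_powerSeries_subst_X_zero,
      subst_zero_X_powerSeries_subst_X_one]
    intro h
    have h2 := congrArg (coeff 2) h
    rw [map_sub, coeff_C, if_neg (by norm_num), coeff_X_pow_mul', if_pos le_rfl, Nat.sub_self,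
      coeff_zero_eq_constantCoeff_apply, V.constantCoeff_formalWDivCube, map_zero] at h2
    norm_num at h2
  · refine ne_zero_of_subst_zero_X_ne_zero ?_
    rw [V.formalGroupLaw_subst_zero_X]; exact PowerSeries.X_ne_zero
  · refine ne_zero_of_subst_zero_X_ne_zero ?_
    rw [V.subst_zero_X_formalGroupLawSub]
    intro h
    have h1 := congrArg (coeff 1) h
    rw [V.coeff_one_formalNeg, map_zero] at h1
    norm_num at h1
  · intro h
    have := congrArg MvPowerSeries.constantCoeff h
    rw [map_ofNat, map_zero] at this
    norm_num at this

variable [hV : V.IsIntegral ℤ_[p]] [V.IsElliptic]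

/-- **The two second logarithmic derivatives agree: `n_L·d_R = n_R·d_L`.** After the
`x`-calculus (`u²N(X(u))`, `X(u)⁴N(ε)`, `εX(u)X(v) = u²X(v) - v²X(u)`, `Ỹ² = 4X³ + ⋯`) this is
exactly the addition formula `formalGroupLaw_addX_identity` (Blakestad–Grant's Lemma 10,
`D₁² log(x(t₁) - x(t₂)) = 2x(t₁) - x(t₁ +_𝓕 t₂) - x(t₁ -_𝓕 t₂)`): a `linear_combination` with
machine-found cofactors, after multiplying through by `2v²X(u)²X(v)²`.
[Blakestad–Grant 2023, Lemma 10 and proof of Prop. 14 ("the second logarithic derivations in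
`t₁` of both sides … agree")] [folklore] -/
theorem thetaLHS_ratio_mul_eq :
    ((-(V.formalXMulSq.subst V.formalGroupLaw + MvPowerSeries.C c * V.formalGroupLaw ^ 2) *
              V.formalGroupLawSub ^ 2 -
            (V.formalXMulSq.subst V.formalGroupLawSub + MvPowerSeries.C c * V.formalGroupLawSub ^ 2) *
              V.formalGroupLaw ^ 2) * (MvPowerSeries.X 0 : MvPowerSeries (Fin 2) ℚ_[p]) ^ 2 +
          2 * ((MvPowerSeries.X 0 : MvPowerSeries (Fin 2) ℚ_[p]) *
              (V.formalInvariantDerivation V.formalEta).subst (MvPowerSeries.X 0 : MvPowerSeries (Fin 2) ℚ_[p]) -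
            V.formalEta.subst (MvPowerSeries.X 0 : MvPowerSeries (Fin 2) ℚ_[p]) ^ 2) *
            V.formalGroupLaw ^ 2 * V.formalGroupLawSub ^ 2) *
        (((X ^ 2 * V.formalWDivCube).subst (MvPowerSeries.X 0 : MvPowerSeries (Fin 2) ℚ_[p]) -
            (X ^ 2 * V.formalWDivCube).subst (MvPowerSeries.X 1 : MvPowerSeries (Fin 2) ℚ_[p])) ^ 2 *
          V.formalXMulSq.subst (MvPowerSeries.X 0 : MvPowerSeries (Fin 2) ℚ_[p]) ^ 2 *
          (MvPowerSeries.X 0 : MvPowerSeries (Fin 2) ℚ_[p]) ^ 2) =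
      ((logDeriv₂Num (V.formalInvariantDerivationMv 0)
              ((X ^ 2 * V.formalWDivCube).subst (MvPowerSeries.X 0 : MvPowerSeries (Fin 2) ℚ_[p]) -
                (X ^ 2 * V.formalWDivCube).subst (MvPowerSeries.X 1 : MvPowerSeries (Fin 2) ℚ_[p])) *
              V.formalXMulSq.subst (MvPowerSeries.X 0 : MvPowerSeries (Fin 2) ℚ_[p]) ^ 2 +
            logDeriv₂Num (V.formalInvariantDerivationMv 0)
                (V.formalXMulSq.subst (MvPowerSeries.X 0 : MvPowerSeries (Fin 2) ℚ_[p])) *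
              ((X ^ 2 * V.formalWDivCube).subst (MvPowerSeries.X 0 : MvPowerSeries (Fin 2) ℚ_[p]) -
                (X ^ 2 * V.formalWDivCube).subst (MvPowerSeries.X 1 : MvPowerSeries (Fin 2) ℚ_[p])) ^ 2) *
            (MvPowerSeries.X 0 : MvPowerSeries (Fin 2) ℚ_[p]) ^ 2 -
          2 * (V.formalXMulSq.subst (MvPowerSeries.X 0 : MvPowerSeries (Fin 2) ℚ_[p]) +
              MvPowerSeries.C c * (MvPowerSeries.X 0 : MvPowerSeries (Fin 2) ℚ_[p]) ^ 2) *
            ((X ^ 2 * V.formalWDivCube).subst (MvPowerSeries.X 0 : MvPowerSeries (Fin 2) ℚ_[p]) -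
              (X ^ 2 * V.formalWDivCube).subst (MvPowerSeries.X 1 : MvPowerSeries (Fin 2) ℚ_[p])) ^ 2 *
            V.formalXMulSq.subst (MvPowerSeries.X 0 : MvPowerSeries (Fin 2) ℚ_[p]) ^ 2) *
        (V.formalGroupLaw ^ 2 * V.formalGroupLawSub ^ 2 *
          (MvPowerSeries.X 0 : MvPowerSeries (Fin 2) ℚ_[p]) ^ 2) := by
  have hNX := V.X_sq_mul_logDeriv₂Num_formalXMulSq_subst
  have hNe := V.formalXMulSq_pow_four_mul_logDeriv₂Num_eps
  have heX := V.eps_mul_formalXMulSq_mul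
  have hAF := V.formalGroupLaw_addX_identity
  have hF0u := V.read_formalYTilde_sq 0
  have hF0v := V.read_formalYTilde_sq 1
  obtain ⟨hXu0, hXv0, -, -, -, h20⟩ := V.stepA_factors_ne_zero
  have hv0 := mvPowerSeries_X_ne_zero (p := p) 1
  set D₁ := V.formalInvariantDerivationMv (0 : Fin 2)
  set u := (MvPowerSeries.X 0 : MvPowerSeries (Fin 2) ℚ_[p])
  set v := (MvPowerSeries.X 1 : MvPowerSeries (Fin 2) ℚ_[p])
  set F := V.formalGroupLaw
  set Fm := V.formalGroupLawSub
  set Xu := V.formalXMulSq.subst u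
  set Xv := V.formalXMulSq.subst v
  set XF := V.formalXMulSq.subst F
  set XFm := V.formalXMulSq.subst Fm
  set ε := (X ^ 2 * V.formalWDivCube).subst u - (X ^ 2 * V.formalWDivCube).subst v
  set Ytu := (MvPowerSeries.C V.a₁ * u - 2) * Xu + MvPowerSeries.C V.a₃ * u ^ 3
  set Ytv := (MvPowerSeries.C V.a₁ * v - 2) * Xv + MvPowerSeries.C V.a₃ * v ^ 3
  -- multiply through by `M = 2v²X(u)²X(v)²` and cancel
  have hM : (2 : MvPowerSeries (Fin 2) ℚ_[p]) * v ^ 2 * Xu ^ 2 * Xv ^ 2 ≠ 0 :=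
    mul_ne_zero (mul_ne_zero (mul_ne_zero h20 (pow_ne_zero 2 hv0)) (pow_ne_zero 2 hXu0)) (pow_ne_zero 2 hXv0)
  refine mul_right_cancel₀ hM ?_
  linear_combination
    ((-2) * u ^ 2 * v ^ 2 * Xu ^ 2 * Xv ^ 2 * F ^ 2 * Fm ^ 2 * ε ^ 2) * hNX +
    ((-2) * u ^ 4 * v ^ 2 * Xv ^ 2 * F ^ 2 * Fm ^ 2) * hNe +
    ((-4) * u ^ 4 * v ^ 2 * Xv * F ^ 2 * Fm ^ 2 * Ytu ^ 2 + (12) * u ^ 4 * v ^ 2 * Xu ^ 3 * Xv * F ^ 2 * Fm ^ 2 +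
      (-2) * u ^ 4 * v ^ 2 * Xu ^ 3 * Xv * XFm * F ^ 2 * ε + (-2) * u ^ 4 * v ^ 2 * Xu ^ 3 * Xv * XF * Fm ^ 2 * ε +
      (2) * u ^ 4 * v ^ 4 * Xu ^ 3 * XFm * F ^ 2 + (2) * u ^ 4 * v ^ 4 * Xu ^ 3 * XF * Fm ^ 2 +
      (2) * u ^ 6 * v ^ 2 * Xu ^ 2 * Xv * F ^ 2 * Fm ^ 2 * MvPowerSeries.C V.b₂ +
      (2) * u ^ 6 * v ^ 2 * Xu ^ 2 * Xv * F ^ 2 * Fm ^ 2 * ε * MvPowerSeries.C V.b₄ +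
      (-2) * u ^ 6 * v ^ 2 * Xu ^ 2 * Xv * XFm * F ^ 2 + (-2) * u ^ 6 * v ^ 2 * Xu ^ 2 * Xv * XF * Fm ^ 2 +
      (-2) * u ^ 6 * v ^ 4 * Xu ^ 2 * F ^ 2 * Fm ^ 2 * MvPowerSeries.C V.b₄ +
      (4) * u ^ 8 * v ^ 2 * Xu * Xv * F ^ 2 * Fm ^ 2 * MvPowerSeries.C V.b₄ +
      (2) * u ^ 8 * v ^ 2 * Xu * Xv * F ^ 2 * Fm ^ 2 * ε * MvPowerSeries.C V.b₆ +
      (-2) * u ^ 8 * v ^ 4 * Xu * F ^ 2 * Fm ^ 2 * MvPowerSeries.C V.b₆ +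
      (2) * u ^ 10 * v ^ 2 * Xv * F ^ 2 * Fm ^ 2 * MvPowerSeries.C V.b₆) * heX +
    ((-1) * u ^ 2 * Xu ^ 2) * hAF +
    ((-1) * u ^ 2 * v ^ 6 * Xu ^ 2 * F ^ 2 * Fm ^ 2 + (4) * u ^ 4 * v ^ 4 * Xu * Xv * F ^ 2 * Fm ^ 2 +
      (-2) * u ^ 6 * v ^ 2 * Xv ^ 2 * F ^ 2 * Fm ^ 2) * hF0u +
    ((-1) * u ^ 8 * Xu ^ 2 * F ^ 2 * Fm ^ 2) * hF0v

end StepA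

end WeierstrassCurve
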